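import Summits.SmoothPoincare4.SmoothPoincare4.Theses.InformationMetricHadamard
import Summits.SmoothPoincare4.SmoothPoincare4.Theorems.InformationMetricHadamardConvexEndRecognitionSphere
import Summits.SmoothPoincare4.SmoothPoincare4.Theorems.InformationMetricHadamardHadamardConvexBoundarySphereRadial
import Literature.Geometry.Riemannian.HopfRinowHeineBorel

/-!
# Stub `stub_hadamardConvexBodyBoundary` (A2) of line `Sketch` for crux `AhHadamardFilling`
(item stmt-SmoothPoincare4-6014, route `InformationMetricHadamard`)

**Convex bodies in a Cartan–Hadamard 5-manifold** (route item `HadamardConvexBoundarySphere`,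
stmt-SmoothPoincare4-6016, with compactness and `range j = frontier C` moved from the hypotheses
to the conclusions). In a complete (closed distance balls compact), simply connected Riemannian
5-manifold `X` with `sec ≤ 0` for every Levi-Civita connection, let `C` be closed and `d`-convex
(betweenness form) with an interior point `o`, and let `j : N → X` be an injective immersion of a
nonempty compact 4-manifold into `frontier C`. Then `C` is compact, `range j = frontier C`, and
`N ≅ S⁴`.

Proof (Eberlein–O'Neill 1973, §1; Lee 2018, Thm. 12.8, Prop. 12.9 — radial projection from `o`),
assembled from the tree's convex-body files of the route
(`Theorems/InformationMetricHadamardConvexEndRecognition{Exp,Rays,Sphere}.lean`,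
`Theorems/InformationMetricHadamardHadamardConvexBoundarySphere{Convex,Radial}.lean`):
`Φ = exp_o : ℝ⁵ ≅ X` is a diffeomorphism (Cartan–Hadamard); the radial map
`Λ(y) = Φ⁻¹(j y)/‖Φ⁻¹(j y)‖ : N → S⁴` is smooth, injective (a ray from `o` meets `frontier C` at
most once, `normalize_injective`) and has injective differential (the frontier is transverse to
the rays, `mfderiv_normalize_injective`), hence is a local diffeomorphism (inverse function
theorem) with open range; the range is also compact, so `Λ` is onto the connected `S⁴`, and a
bijective local diffeomorphism is a diffeomorphism. Consequently every ray from `o` meets `j(N)`,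
beyond which it has left `C` (between `o` and a point of `C` there are only interior points): so
`Φ⁻¹ C` is bounded by `max ‖Φ⁻¹ ∘ j‖`, i.e. `C` is compact, and every frontier point, lying on some
ray, is the point of `j(N)` on that ray. The relative openness of `range j` in `frontier C` is not
needed.

References: P. Eberlein, B. O'Neill, *Visibility manifolds*, Pacific J. Math. 46 (1973), §1;
J. M. Lee, *Introduction to Riemannian Manifolds*, 2nd ed. (2018), Thm. 12.8, Prop. 12.9
[LeeRiemannianManifolds2018].
-/

noncomputable section

-- the prescribed namespace `Summit.<P>.<Sub>.…` duplicates `SmoothPoincare4` (P = Sub)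
set_option linter.dupNamespace false

open scoped Manifold ContDiff Topology ENNReal NNReal
open Set Function

namespace Summit.SmoothPoincare4.SmoothPoincare4.Cruxes.AhHadamardFilling.Sketch

open Literature.Geometry.Lorentzian (PseudoRiemannianMetric)
open Literature.Geometry.Lorentzian Literature.Geometry.Lorentzian.PseudoRiemannianMetric
  Literature.Geometry.Riemannian Literature.Geometry.Riemannian.SimpleAH
  Literature.Topology.FourManifolds
  Summit.SmoothPoincare4.SmoothPoincare4.Theorems.HadamardConvex
  Summit.SmoothPoincare4.SmoothPoincare4.Theorems.HadamardConvexBoundary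

set_option maxSynthPendingDepth 3 in
/-- **A2 (convex bodies in Hadamard manifolds; item 6016 strengthened).** In a complete simply
connected Riemannian 5-manifold with `sec ≤ 0`, let `C` be closed and `d`-convex with nonempty
interior, and let `j : N → X` be an injective immersion of a nonempty compact 4-manifold whose image
lies in `frontier C` and is relatively open there. Then `C` is compact, `range j = frontier C`, and
`N ≅ S⁴` (radial geodesic projection from an interior point is a diffeomorphism onto the unit
sphere: `exp_o` is a diffeomorphism, Lee 2018 Thm. 12.8 / Prop. 12.9; each ray leaves `C` at most
once and, where it meets the smooth frontier piece, transversally; a compact open subset of the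
connected sphere of directions is all of it).
[cite: LeeRiemannianManifolds2018, Thm. 12.8 and Prop. 12.9] -/
theorem stub_hadamardConvexBodyBoundary
    (X : Type) [TopologicalSpace X] [T2Space X] [SecondCountableTopology X]
    [ChartedSpace (EuclideanSpace ℝ (Fin 5)) X] [IsManifold (𝓡 5) ∞ X] [SimplyConnectedSpace X]
    (G : PseudoRiemannianMetric (𝓡 5) ∞ (EuclideanSpace ℝ (Fin 5)) (TangentSpace (𝓡 5) : X → Type _))
    (hG : G.IsRiemannian) :
    (∀ (x : X) (r : NNReal), IsCompact {y : X | G.edist hG x y ≤ r}) →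
    (∀ cov, G.IsLeviCivita cov →
      ∀ (x : X) (U V : TangentSpace (𝓡 5) x), G.sectionalCurvature cov x U V ≤ 0) →
    ∀ (C : Set X), IsClosed C → (interior C).Nonempty →
    (∀ p ∈ C, ∀ q ∈ C, ∀ m : X, G.edist hG p m + G.edist hG m q = G.edist hG p q → m ∈ C) →
    ∀ (N : Type) [TopologicalSpace N] [T2Space N] [SecondCountableTopology N] [CompactSpace N]
      [Nonempty N] [ChartedSpace (EuclideanSpace ℝ (Fin 4)) N] [IsManifold (𝓡 4) ∞ N] (j : N → X),
    ContMDiff (𝓡 4) (𝓡 5) ∞ j → Injective j →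
    (∀ x : N, Injective (mfderiv (𝓡 4) (𝓡 5) j x)) → range j ⊆ frontier C →
    IsOpen (((↑) : frontier C → X) ⁻¹' range j) →
    IsCompact C ∧ range j = frontier C ∧ Nonempty (N ≃ₘ⟮𝓡 4, 𝓡 4⟯ (Metric.sphere (0 : EuclideanSpace ℝ (Fin 5)) 1)) := by
  intro hcpt hsec C hC hCint hconv N _ _ _ _ _ _ _ j hj hjinj hjimm hrange _
  -- the Levi-Civita connection of `G` and its regularity
  haveI hLC : G.HasLeviCivita := G.hasLeviCivita
  have hk1 : ((1 : ℕ∞) : ℕ∞ω) + 1 ≤ (∞ : ℕ∞ω) := by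
    rw [show ((1 : ℕ∞) : ℕ∞ω) + 1 = 2 by norm_num]
    exact WithTop.coe_le_coe.2 le_top
  have hktop : ((⊤ : ℕ∞) : ℕ∞ω) + 1 ≤ (∞ : ℕ∞ω) := le_of_eq rfl
  have h2 : (2 : ℕ∞ω) ≤ (∞ : ℕ∞ω) := WithTop.coe_le_coe.2 le_top
  haveI : CovariantDerivative.ContMDiffCovariantDerivative G.leviCivita 1 :=
    ⟨G.isLocallyContMDiff_leviCivita_holds 1 hk1 univ isOpen_univ⟩
  haveI : CovariantDerivative.ContMDiffCovariantDerivative G.leviCivita ∞ :=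
    ⟨G.isLocallyContMDiff_leviCivita_holds ⊤ hktop univ isOpen_univ⟩
  -- nonpositive sectional curvature ⇒ `Rm(X, Y, Y, X) ≤ 0` on all pairs
  have hLCiv : G.IsLeviCivita G.leviCivita := isLeviCivita_leviCivita_holds (g := G)
  have hsec' : ∀ (x : X) (U V : TangentSpace (𝓡 5) x),
      G.curvatureForm G.leviCivita x U V V U ≤ 0 :=
    curvatureForm_leviCivita_nonpos_of_orthonormal h2 hG fun x U V hU hV hUV ↦ by
      rw [← sectionalCurvature_of_orthonormal G G.leviCivita x hU hV hUV]
      exact hsec _ hLCiv x U V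
  -- Heine–Borel ⇒ geodesically complete (Hopf–Rinow)
  haveI : LocallyPathConnectedSpace X :=
    ChartedSpace.locallyPathConnectedSpace (EuclideanSpace ℝ (Fin 5)) X
  have hc : IsGeodesicallyComplete G.leviCivita :=
    (isGeodesicallyComplete_iff_isCompact_setOf_edist_le G le_rfl hG).2 hcpt
  haveI hfact : Fact (Module.finrank ℝ (EuclideanSpace ℝ (Fin 5)) = 4 + 1) :=
    ⟨finrank_euclideanSpace_fin⟩
  -- the interior point `o` and the diffeomorphism `Φ = exp_o`
  obtain ⟨o, ho⟩ := hCint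
  obtain ⟨Φ, hΦ'⟩ := exists_expDiffeomorph hG hc hsec' o
  have hΦ : ∀ v : EuclideanSpace ℝ (Fin 5), Φ v = expMap G.leviCivita o v := fun v ↦ congr_fun hΦ' v
  have hΦ0 : Φ 0 = o := by rw [hΦ]; exact expMap_zero (cov := G.leviCivita) o
  have hjfr : ∀ y, j y ∈ frontier C := fun y ↦ hrange (mem_range_self y)
  have hne : ∀ y, Φ.symm (j y) ≠ 0 := symm_ne_zero ho hrange Φ hΦ0
  -- strictly between `o` and a point of `C` there are only interior points
  have hbetween : ∀ w : EuclideanSpace ℝ (Fin 5), Φ w ∈ C → ∀ c : ℝ, 0 < c → c < 1 →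
      Φ (c • w) ∈ interior C := by
    intro w hw c hc0 hc1
    -- reverse the segment from `o` to `Φ w ∈ C` and apply the open-cone lemma at `Φ w`
    have key : ∀ v : TangentSpace (𝓡 5) o, expMap G.leviCivita o v ∈ C →
        expMap G.leviCivita o (c • v) ∈ interior C := by
      intro v hv
      have hrev := expMap_expMap_smul_neg (g := G) hc o v (1 - c)
      rw [sub_sub_cancel] at hrev
      rw [← hrev]
      refine expMap_smul_mem_interior hG hc hsec' hconv hv ?_ (by linarith) (by linarith)
      rw [expMap_expMap_neg (g := G) hc o]
      exact ho
    have h := key w (by rw [← hΦ]; exact hw)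
    rw [← hΦ] at h
    exact h
  -- the radial map `Λ : N → S⁴`
  set Λ : N → EuclideanSpace ℝ (Fin 5) := fun y ↦ ‖Φ.symm (j y)‖⁻¹ • Φ.symm (j y) with hΛ
  have hΛmem : ∀ y, Λ y ∈ Metric.sphere (0 : EuclideanSpace ℝ (Fin 5)) 1 := fun y ↦ by
    rw [mem_sphere_zero_iff_norm, hΛ, norm_smul, norm_inv, norm_norm,
      inv_mul_cancel₀ (norm_ne_zero_iff.2 (hne y))]
  set La : N → Metric.sphere (0 : EuclideanSpace ℝ (Fin 5)) 1 := Set.codRestrict Λ _ hΛmem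
    with hLa
  have hΛs : ContMDiff (𝓡 4) 𝓘(ℝ, EuclideanSpace ℝ (Fin 5)) ∞ Λ :=
    contDiffOn_normalize.contMDiffOn.comp_contMDiff (Φ.symm.contMDiff.comp hj) fun y ↦ hne y
  have hLas : ContMDiff (𝓡 4) (𝓡 4) ∞ La := hΛs.codRestrict_sphere hΛmem
  have hΛinj : Injective Λ := normalize_injective hG hc hsec' hconv hC ho hjinj hrange Φ hΦ
  have hLainj : Injective La := fun a b h ↦ hΛinj (congrArg Subtype.val h)
  -- transversality: `Λ` is a local diffeomorphism (inverse function theorem)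
  have hLaloc : IsLocalDiffeomorph (𝓡 4) (𝓡 4) ∞ La := by
    intro x
    refine isLocalDiffeomorphAt_of_mfderiv_injective isOpen_univ (mem_univ x) hLas.contMDiffOn
      (by exact_mod_cast le_top) rfl ?_
    have hd : Injective (mfderiv (𝓡 4) 𝓘(ℝ, EuclideanSpace ℝ (Fin 5)) Λ x) :=
      mfderiv_normalize_injective hG hc hsec' hconv hC ho hj hjimm hrange Φ hΦ x
    have hcomp : mfderiv (𝓡 4) 𝓘(ℝ, EuclideanSpace ℝ (Fin 5)) Λ x =
        (mfderiv (𝓡 4) 𝓘(ℝ, EuclideanSpace ℝ (Fin 5)) Subtype.val (La x)).comp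
          (mfderiv (𝓡 4) (𝓡 4) La x) :=
      mfderiv_comp x ((contMDiff_coe_sphere (m := ∞)).mdifferentiableAt (by simp))
        (hLas.mdifferentiableAt (by simp))
    rw [hcomp] at hd
    have hd' : Injective ((mfderiv (𝓡 4) 𝓘(ℝ, EuclideanSpace ℝ (Fin 5)) Subtype.val (La x) :
        _ → EuclideanSpace ℝ (Fin 5)) ∘ (mfderiv (𝓡 4) (𝓡 4) La x)) := hd
    exact hd'.of_comp
  -- `Λ` is onto: its range is open, compact, nonempty, and `S⁴` is connected
  have hLasurj : Surjective La := by
    haveI : PreconnectedSpace (Metric.sphere (0 : EuclideanSpace ℝ (Fin 5)) 1) := by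
      refine Subtype.preconnectedSpace (isPreconnected_sphere ?_ 0 1)
      rw [← Module.finrank_eq_rank, finrank_euclideanSpace_fin]
      norm_num
    have hclopen : IsClopen (range La) :=
      ⟨(isCompact_range hLas.continuous).isClosed, hLaloc.isOpen_range⟩
    exact Set.range_eq_univ.1 (hclopen.eq_univ (range_nonempty La))
  -- hence every ray from `o` meets `j(N)`
  have hray : ∀ w : EuclideanSpace ℝ (Fin 5), w ≠ 0 →
      ∃ y, Φ.symm (j y) = (‖Φ.symm (j y)‖ * ‖w‖⁻¹) • w := by
    intro w hw
    obtain ⟨y, hy⟩ := hLasurj ⟨‖w‖⁻¹ • w, by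
      rw [mem_sphere_zero_iff_norm, norm_smul, norm_inv, norm_norm,
        inv_mul_cancel₀ (norm_ne_zero_iff.2 hw)]⟩
    have hy' : ‖Φ.symm (j y)‖⁻¹ • Φ.symm (j y) = ‖w‖⁻¹ • w := congrArg Subtype.val hy
    refine ⟨y, ?_⟩
    calc Φ.symm (j y) = ‖Φ.symm (j y)‖ • (‖Φ.symm (j y)‖⁻¹ • Φ.symm (j y)) := by
          rw [smul_smul, mul_inv_cancel₀ (norm_ne_zero_iff.2 (hne y)), one_smul]
      _ = (‖Φ.symm (j y)‖ * ‖w‖⁻¹) • w := by rw [hy', smul_smul]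
  -- `C` is compact: `Φ⁻¹ C` is bounded by the maximum of `‖Φ⁻¹ ∘ j‖`
  obtain ⟨R, hR⟩ :=
    (isCompact_range (Φ.symm.continuous.comp hj.continuous)).isBounded.exists_norm_le
  have hbound : ∀ q ∈ C, ‖Φ.symm q‖ ≤ R := by
    intro q hq
    by_cases hw : Φ.symm q = 0
    · obtain ⟨y⟩ := ‹Nonempty N›
      rw [hw, norm_zero]
      exact (norm_nonneg _).trans (hR _ ⟨y, rfl⟩)
    obtain ⟨y, hy⟩ := hray _ hw
    have hsR : ‖Φ.symm (j y)‖ ≤ R := hR _ ⟨y, rfl⟩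
    by_contra hlt
    have hws : ‖Φ.symm (j y)‖ < ‖Φ.symm q‖ := hsR.trans_lt (not_le.1 hlt)
    have hqpos : 0 < ‖Φ.symm q‖ := norm_pos_iff.2 hw
    have hc0 : 0 < ‖Φ.symm (j y)‖ * ‖Φ.symm q‖⁻¹ :=
      mul_pos (norm_pos_iff.2 (hne y)) (inv_pos.2 hqpos)
    have hc1 : ‖Φ.symm (j y)‖ * ‖Φ.symm q‖⁻¹ < 1 := by
      rwa [mul_inv_lt_iff₀ hqpos, one_mul]
    have hint := hbetween (Φ.symm q) (by rw [Φ.apply_symm_apply]; exact hq) _ hc0 hc1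
    rw [← hy, Φ.apply_symm_apply] at hint
    exact (hjfr y).2 hint
  have hCK : IsCompact C := by
    refine ((isCompact_closedBall (0 : EuclideanSpace ℝ (Fin 5)) R).image
      Φ.continuous).of_isClosed_subset hC fun q hq ↦ ?_
    exact ⟨Φ.symm q, mem_closedBall_zero_iff.2 (hbound q hq), Φ.apply_symm_apply q⟩
  -- `frontier C = range j`: a frontier point is the point of `j(N)` on its ray
  have hfr : range j = frontier C := by
    refine hrange.antisymm fun q hq ↦ ?_
    have hw : Φ.symm q ≠ 0 := fun h0 ↦ by
      have h1 : q = o := by rw [← Φ.apply_symm_apply q, h0, hΦ0]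
      exact hq.2 (h1 ▸ ho)
    obtain ⟨y, hy⟩ := hray _ hw
    have hs0 : 0 < ‖Φ.symm (j y)‖ * ‖Φ.symm q‖⁻¹ :=
      mul_pos (norm_pos_iff.2 (hne y)) (inv_pos.2 (norm_pos_iff.2 hw))
    have hfr1 : expMap G.leviCivita o
        (show TangentSpace (𝓡 5) o from (1 : ℝ) • Φ.symm q) ∈ frontier C := by
      rw [one_smul, ← hΦ, Φ.apply_symm_apply]; exact hq
    have hfr2 : expMap G.leviCivita o (show TangentSpace (𝓡 5) o from
        (‖Φ.symm (j y)‖ * ‖Φ.symm q‖⁻¹) • Φ.symm q) ∈ frontier C := by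
      rw [← hy, ← hΦ, Φ.apply_symm_apply]; exact hjfr y
    have hs1 : ‖Φ.symm (j y)‖ * ‖Φ.symm q‖⁻¹ = 1 := by
      rcases le_total (‖Φ.symm (j y)‖ * ‖Φ.symm q‖⁻¹) 1 with h | h
      · exact eq_of_expMap_smul_mem_frontier hG hc hsec' hC hconv ho hs0 h hfr2 hfr1
      · exact (eq_of_expMap_smul_mem_frontier hG hc hsec' hC hconv ho one_pos h hfr1 hfr2).symm
    rw [hs1, one_smul] at hy
    refine ⟨y, ?_⟩
    have h := congrArg Φ hy
    rwa [Φ.apply_symm_apply, Φ.apply_symm_apply] at h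
  exact ⟨hCK, hfr, ⟨hLaloc.diffeomorphOfBijective ⟨hLainj, hLasurj⟩⟩⟩

end Summit.SmoothPoincare4.SmoothPoincare4.Cruxes.AhHadamardFilling.Sketch

end
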